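import Literature.AnabelianGeometry.Anabelioids.ExactFunctorProofs
import Literature.AnabelianGeometry.Anabelioids.FiberFunctorUnique
import Mathlib.CategoryTheory.Galois.Topology
import HarnessLib

/-!
# Anabelioids: named facts of `Anabelioids/Basic.lean`, V — relative slimness ⇒ slim target

Mochizuki, *The geometry of anabelioids*, Publ. RIMS **40** (2004), §1.2, Remark 1.2.9.1, author's
manuscript p. 24 [cite: MochizukiGeoAn2004, Rem. 1.2.9.1 p.24], third assertion: "If `U → V` is a
relatively slim morphism between connected anabelioids, then it follows that `V` is slim".  The
statement file `Literature.AnabelianGeometry.Anabelioids.Basic` records it as the named fact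
`isSlim_target_of_isRelativelySlim` (abc-iut cell node `GeoAn:Rmk1.2.9.1`, third claim); this
proof-only companion discharges it AS TYPED.

Proof.  Choose a basepoint `β` of `X` (Mathlib's `GaloisCategory.hasFiberFunctor`).  By the tree's
`fiberFunctor_comp_of_exact` ([SGA1] V 6.1; `ExactFunctorProofs.lean`) `φ ∘ β := φ^* ⋙ β` is a
basepoint of `Y`, and `π₁(φ) : π₁(X, β) → π₁(Y, φ ∘ β)` is continuous (it is a coordinate
projection for Mathlib's product topologies).  Relative slimness of `π₁(φ)` at the open subgroup
`π₁(φ)⁻¹(V)` shows that every open subgroup `V ⊆ π₁(Y, φ ∘ β)` has trivial centralizer, i.e.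
`π₁(Y, φ ∘ β)` is slim; by independence of the basepoint (the tree's
`isSlim_iff_isSlimGroup_aut`, [SGA1] V 5.7, `FiberFunctorUnique.lean`) `π₁(Y, β')` is slim for
EVERY basepoint `β'`, which is the typed `IsSlim Y`.  Proof-only file: no definitions; nothing of
the statement file is restated.
-/

namespace Literature.AnabelianGeometry.Anabelioids

open CategoryTheory CategoryTheory.Limits CategoryTheory.PreGaloisCategory
open Literature.AlgebraicGeometry.Frobenioids (IsSlimGroup)

universe v₁ v₂ u₁ u₂

/-- The homomorphism `π₁(φ) : π₁(X, β) → π₁(Y, φ ∘ β)` induced on fundamental groups is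
continuous for Mathlib's (profinite) topologies on automorphism groups of fibre functors (local
copy; a public copy lives in `SemiGraphs/CommensurabilityProofs4.lean`). [folklore] -/
private theorem continuous_pi1Map {X : Type u₁} [Category.{v₁} X] {Y : Type u₂} [Category.{v₂} Y]
    (P : Y ⥤ X) (F : X ⥤ FintypeCat.{v₁}) : Continuous (pi1Map P F) := by
  rw [(autEmbedding_isClosedEmbedding (P ⋙ F)).isInducing.continuous_iff, continuous_pi_iff]
  intro B
  have hco : (fun σ : Aut F => autEmbedding (P ⋙ F) (pi1Map P F σ) B) =
      fun σ => autEmbedding F σ (P.obj B) := by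
    funext σ
    exact Iso.ext rfl
  change Continuous fun σ : Aut F => autEmbedding (P ⋙ F) (pi1Map P F σ) B
  rw [hco]
  exact (continuous_apply _).comp (autEmbedding_isClosedEmbedding F).continuous

/-- Slimness of a topological group is invariant under isomorphisms of topological groups (local
copy of the private helper of `FiberFunctorUnique.lean`). [folklore] -/
private theorem isSlimGroup_of_continuousMulEquiv' {G₁ G₂ : Type*} [Group G₁]
    [TopologicalSpace G₁] [Group G₂] [TopologicalSpace G₂] (e : G₁ ≃ₜ* G₂)
    (h : IsSlimGroup G₁) : IsSlimGroup G₂ := by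
  refine ⟨fun H hH => ?_⟩
  have hH' : IsOpen ((H.comap e.toMonoidHom : Subgroup G₁) : Set G₁) := hH.preimage e.continuous
  have h1 := h.centralizer_eq_bot (H.comap e.toMonoidHom) hH'
  rw [eq_bot_iff] at h1 ⊢
  intro z hz
  have hz' :
      e.symm z ∈ Subgroup.centralizer ((H.comap e.toMonoidHom : Subgroup G₁) : Set G₁) := by
    rw [Subgroup.mem_centralizer_iff]
    intro g hg
    apply e.injective
    have := Subgroup.mem_centralizer_iff.mp hz (e g) hg
    simpa using this
  have := h1 hz'
  rw [Subgroup.mem_bot] at this ⊢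
  simpa using congrArg e this

/-- **[GeoAn] Remark 1.2.9.1, third assertion** (p. 24): a relatively slim morphism `φ : X → Y`
of connected anabelioids has slim target — the named fact `isSlim_target_of_isRelativelySlim`
HOLDS (for every basepoint of `Y`, via independence of the basepoint).
[cite: MochizukiGeoAn2004, Rem. 1.2.9.1 p.24] -/
theorem isSlim_target_of_isRelativelySlim_holds :
    isSlim_target_of_isRelativelySlim.{v₁, v₂, u₁, u₂} := by
  intro X _ Y _ _ _ φ hslim
  -- a basepoint `β` of `X` and the induced basepoint `φ ∘ β` of `Y`
  obtain ⟨F, ⟨hF⟩⟩ := @GaloisCategory.hasFiberFunctor X _ _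
  haveI : PreservesFiniteLimits φ.pullback := φ.property.1
  haveI : PreservesFiniteColimits φ.pullback := φ.property.2
  haveI : FiberFunctor (φ.pullback ⋙ F) := fiberFunctor_comp_of_exact φ.pullback F
  -- `π₁(Y, φ ∘ β)` is slim
  have hslimY : IsSlimGroup (Aut (φ.pullback ⋙ F)) := by
    refine ⟨fun V hV => ?_⟩
    have hU : IsOpen ((V.comap (pi1Map φ.pullback F) : Subgroup (Aut F)) : Set (Aut F)) :=
      hV.preimage (continuous_pi1Map φ.pullback F)
    have h := (hslim F).centralizer_eq_bot (V.comap (pi1Map φ.pullback F)) hU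
    rw [eq_bot_iff] at h ⊢
    exact le_trans (Subgroup.centralizer_le (Set.image_preimage_subset _ _)) h
  -- move the induced basepoint into the universe of `Y`'s basepoints (`FintypeCat.uSwitch`)
  have e : Aut (φ.pullback ⋙ F) ≃ₜ* Aut ((φ.pullback ⋙ F) ⋙ FintypeCat.uSwitch.{v₁, v₂}) :=
    autEquivAutWhiskerRight (φ.pullback ⋙ F)
      (Functor.FullyFaithful.ofFullyFaithful FintypeCat.uSwitch.{v₁, v₂})
  have hslimY' : IsSlimGroup (Aut ((φ.pullback ⋙ F) ⋙ FintypeCat.uSwitch.{v₁, v₂})) :=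
    isSlimGroup_of_continuousMulEquiv' e hslimY
  -- hence `π₁(Y, β')` is slim for every basepoint `β'`
  exact (isSlim_iff_isSlimGroup_aut ((φ.pullback ⋙ F) ⋙ FintypeCat.uSwitch.{v₁, v₂})).mpr hslimY'

end Literature.AnabelianGeometry.Anabelioids
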